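import Summits.BirchSwinnertonDyer.BirchSwinnertonDyer.Theorems.PrintCf2SplitBadTwoLayerDualShapiroReading
import Summits.BirchSwinnertonDyer.BirchSwinnertonDyer.Theorems.PrintCf2SplitBadTwoKummerUClassLevelTwistedRamified
import HarnessLib

/-!
# Crux `PrintCf2.SplitBadTwoRankOneOfFacts` (stmt-BirchSwinnertonDyer-20368), skeleton v13.4, registered stub (REG₂) `stub_xRegular_two`,
# S3N-FACTFREE road R2 (road (b), `U`-currency), brick B3d′ (TWISTED twin of B3d, p706446): (SUR_U) AT A PAIR OF LEVELS from the CLASS-LEVEL (PRO-NULL)_U for SIGN-TWISTED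
# coefficients — B2d (`exists_layerClass_of_layerProNull`, p705484) ∘ -w4 g14's `KummerUDict.exists_level_resH1Hom_eq_zero_of_local_twisted_ramified`
# (p705557), with B2c's Selmer-structure bookkeeping DISCHARGED and ONE displayed local input left: the twisted `v̄`-reading (B5-U)

Cell `bsd-print-cf2`, WIDTH seat `bsd-line-cf2-p1-w8` g5 (prover-bsd-line-cf2-p1-w8-g5-0); `--supports stmt-BirchSwinnertonDyer-20368`
(helper, Theses-free). HONEST FRAMING: nothing here closes the crux or a registered stub; BSD is not proved by any of this; no summit
statement is proved by this seat. No definition, no named fact, no `sorry`. Unconditional in its displayed hypotheses.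

SETTING. `K` imaginary quadratic, `p = v·v̄` split (`hall`: `v`, `v̄` are the primes above `p`), `F ⊆ K̄` finite ABELIAN over `K` with
`U = Gal(K̄/F)` open normal (a layer `K*_n` of the `v̄`-line); a SIGN `ε : Γ_K →* ℤˣ` (the sign of the order-two `θ₀`) with `U′ = Gal(K̄/F′) =
U ∩ ker ε` (`F′ = F·K_ε`, abelian over `K`; -w4 g14 `exists_twistedLayerField`); the dual models are `ε`-TWISTED Kummer modules
(`ι′(g•x) = (g•ι′ x)^{ε g}`). A PAIR OF LEVELS of a divisible module:
finite discrete `Γ_K`-modules `N₀ →j N` (`N` killed by `p^M`) with DUAL MODELS `N₀′`, `N′` — perfect equivariant pairings `B₀ : N₀ × N₀′ → μ_{p^M}`,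
`B : N × N′ → μ_{p^M}` (`hB`, `hBbij`), the transpose `jD : N′ → N₀′` of `j`, and KUMMER EMBEDDINGS `ι′ : N′ ↪ K̄ˣ`, `ι₀′ : N₀′ ↪ K̄ˣ`
(equivariant, `ι₀′` onto `⊇ μ_{p^k}`, `ι₀′ ∘ jD = (·)^{p^{M−k}} ∘ ι′`) — e.g. `N = ℤ/p^M`, `N′ = μ_{p^M}`, `j = ·p^{M−k}`, `jD = (·)^{p^{M−k}}`.

WHAT. **`exists_level_levelSurj_of_classProNull_twisted`**: for every `k` there is `M ≥ k` (the level of p705557) such that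
for ALL such level data at `(k, M)` with `Maps(Γ_K ⧸ U, N)` unramified at every `w ∤ p` off a finite set `Sε` (`hSε`) and, at every `w ∤ p`,
EITHER unramified OR `I_w ≤ U` with `ε(I_w) ≠ 1` (`hram` — the `S_ε`-places, -w4 g14's non-split valuation trick p704813), and GIVEN the
twisted `v̄`-reading `hB5` («clause (iii) of B2d at `v̄` ⟹ at every `w′ ∣ v̄` of `F′`: `p^M ∣ ord_{w′}(b′)` OR `w′` is NOT split over `F`»,
the `(v̄)` hypothesis of p705557 VERBATIM as conclusion; displayed),
(SUR_U) HOLDS AT THE LEVELS `(N₀, N, j)`: every family of layer-local targets `τ₀ w q ∈ H¹(U ⊓ D_w^q, N₀)` above a finite `T` (`w ∤ p` or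
`w = v̄`) is realised by a class `z ∈ H¹(U, N)` modulo classes dying on `U ⊓ I_w`, unramified above every other `w ∤ p` / `v̄` — VERBATIM the
hypothesis `hlev` of B3c `locSurj_torsionExponent_of_levelSurj` (p706017). Inside: the Selmer structure `𝓕 = (⊤ at v and ∞ | H¹_ur elsewhere)` on
`Maps(Γ_K ⧸ U, N)`, the bad set `S = ∞ ∪ {v, v̄} ∪ T`, the intertwining map `ιc = Maps(Γ_K ⧸ U, j)`, and the verification of B2c's `hS`/`h𝓕S`/`h𝓕u`.
USE: B3c turns this into (SUR_U) for `A_θ` (`θ = 1`) at every layer, then (LSₙ) and -w2 g14's socket `XRegPinned.stub_xRegular_two_of_locSurjLayers`;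
this IS the twisted case; the untwisted one is B3d (p706446). presearch: GV2000 §2 Prop. 2.1, Greenberg LNM 1716 §4 — assembly of tree theorems, no new fact. beyond-print theorem: no.

References: [GreenbergVatsal2000] §2 Prop. 2.1; [GreenbergLNM1716] §4 Props. 4.13–4.15; [MilneADT2006] I Thm. 4.10 (b); [deShalit1987] III.2.3.
-/

noncomputable section

open scoped Classical ContRepresentation Pointwise

set_option linter.dupNamespace false
set_option autoImplicit false

open CategoryTheory NumberField IsDedekindDomain Field
open Literature.NumberTheory.EllipticCurves Literature.NumberTheory.EllipticCurves.GreenbergSelmer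
open Literature.NumberTheory.EllipticCurves.GreenbergVatsal2000
open Literature.NumberTheory.GaloisRepresentations Literature.NumberTheory.GaloisRepresentations.LocalWeilDatum
open Literature.NumberTheory.GaloisRepresentations.DiscreteGaloisModule (SelmerStructure mu MuCarrier TateDual tateDual
  coindTateDualMor coindTateDualHom)
open Literature.NumberTheory.GaloisCohomology
open Summit.BirchSwinnertonDyer.Rank1Residual.X11b.LocBridge

namespace Summit.BirchSwinnertonDyer.BirchSwinnertonDyer.Theorems.PrintCf2.LayerShapiro

variable {K : Type} [Field K] [NumberField K] {p : ℕ} [Fact p.Prime]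

/-- **(SUR_U) AT A PAIR OF LEVELS FROM THE CLASS-LEVEL (PRO-NULL)_U AND THE `v̄`-READING, SIGN-TWISTED COEFFICIENTS.** See the module
docstring. [cite: NeukirchSchmidtWingberg2008, (1.6.6)–(1.6.7)]
[cite: GreenbergVatsal2000, §2 Prop. 2.1] [cite: MilneADT2006, Ch. I, Thm. 4.10 (b)] [cite: deShalit1987, III.2.3 (Theorem (Baker–Brumer))] -/
theorem exists_level_levelSurj_of_classProNull_twisted (hK : IsImaginaryQuadratic K) {v vbar : HeightOneSpectrum (𝓞 K)}
    (hv : ((p : ℕ) : 𝓞 K) ∈ v.asIdeal) (hvbar : ((p : ℕ) : 𝓞 K) ∈ vbar.asIdeal) (hne : vbar ≠ v)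
    (hall : ∀ w : HeightOneSpectrum (𝓞 K), ((p : ℕ) : 𝓞 K) ∈ w.asIdeal → w = v ∨ w = vbar)
    (F F' : IntermediateField K (AlgebraicClosure K)) [FiniteDimensional K F'] [IsAbelianGalois K F'] [NumberField F']
    [(galFixing K F).Normal] [(galFixing K F').Normal] (ε : absoluteGaloisGroup K →* ℤˣ)
    (hU' : galFixing K F' ≤ galFixing K F) (hεU' : ∀ u ∈ galFixing K F', ε u = 1)
    (hker : ∀ u ∈ galFixing K F, ε u = 1 → u ∈ galFixing K F')
    (hUopen : IsOpen (galFixing K F : Set (absoluteGaloisGroup K)))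
    [Fintype (absoluteGaloisGroup K ⧸ galFixing K F)] (k : ℕ) :
    ∃ M : ℕ, k ≤ M ∧
      ∀ {N₀ : Type} [AddCommGroup N₀] [DistribMulAction (absoluteGaloisGroup K) N₀] [TopologicalSpace N₀] [DiscreteTopology N₀]
        [Finite N₀]
        {N : Type} [AddCommGroup N] [DistribMulAction (absoluteGaloisGroup K) N] [TopologicalSpace N] [DiscreteTopology N] [Finite N]
        {N₀' : Type} [AddCommGroup N₀'] [DistribMulAction (absoluteGaloisGroup K) N₀'] [TopologicalSpace N₀'] [DiscreteTopology N₀']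
        {N' : Type} [AddCommGroup N'] [DistribMulAction (absoluteGaloisGroup K) N'] [TopologicalSpace N'] [DiscreteTopology N']
        (hN₀ : ∀ m : N₀, IsOpen {σ : absoluteGaloisGroup K | σ • m = m}) (hN : ∀ m : N, IsOpen {σ : absoluteGaloisGroup K | σ • m = m})
        (hN₀' : ∀ m : N₀', IsOpen {σ : absoluteGaloisGroup K | σ • m = m})
        (hN' : ∀ m : N', IsOpen {σ : absoluteGaloisGroup K | σ • m = m})
        (hMN : ∀ x : N, p ^ M • x = 0) (hMN' : ∀ x : N', p ^ M • x = 0)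
        (j : N₀ →+ N) (hj : ∀ (σ : absoluteGaloisGroup K) (m : N₀), j (σ • m) = σ • j m)
        (B : N →+ N' →+ MuCarrier K (p ^ M))
        (hB : ∀ (σ : absoluteGaloisGroup K) (m : N) (m' : N'), B (ofSMul N hN σ m) (ofSMul N' hN' σ m') = mu K (p ^ M) σ (B m m'))
        (hBbij : Function.Bijective fun m' : N' ↦ B.flip m')
        (B₀ : N₀ →+ N₀' →+ MuCarrier K (p ^ M))
        (hB₀ : ∀ (σ : absoluteGaloisGroup K) (m : N₀) (m' : N₀'),
          B₀ (ofSMul N₀ hN₀ σ m) (ofSMul N₀' hN₀' σ m') = mu K (p ^ M) σ (B₀ m m'))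
        (jD : N' →+ N₀') (hjD : ∀ (σ : absoluteGaloisGroup K) (m' : N'), jD (σ • m') = σ • jD m')
        (hBj : ∀ (m₀ : N₀) (m' : N'), B₀ m₀ (jD m') = B (j m₀) m')
        (ι' : N' →+ Additive (AlgebraicClosure K)ˣ) (hι'inj : Function.Injective ι')
        (hι' : ∀ (g : absoluteGaloisGroup K) (x : N'), Additive.toMul (ι' (g • x)) = (g • Additive.toMul (ι' x)) ^ ((ε g : ℤˣ) : ℤ))
        (ι₀' : N₀' →+ Additive (AlgebraicClosure K)ˣ) (hι₀'inj : Function.Injective ι₀')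
        (hι₀' : ∀ (g : absoluteGaloisGroup K) (x : N₀'), Additive.toMul (ι₀' (g • x)) = (g • Additive.toMul (ι₀' x)) ^ ((ε g : ℤˣ) : ℤ))
        (hι₀'surj : ∀ m : (AlgebraicClosure K)ˣ, m ^ p ^ k = 1 → ∃ a₀ : N₀', Additive.toMul (ι₀' a₀) = m)
        (htι : ∀ x : N', Additive.toMul (ι₀' (jD x)) = Additive.toMul (ι' x) ^ p ^ (M - k))
        (Sε : Finset (HeightOneSpectrum (𝓞 K)))
        (hSε : ∀ w : HeightOneSpectrum (𝓞 K), w ∉ Sε → ((p : ℕ) : 𝓞 K) ∉ w.asIdeal →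
          GaloisRep.IsUnramifiedAt w ((ofSMul N hN).coind (galFixing K F) hUopen))
        (hram : ∀ w : HeightOneSpectrum (𝓞 K), ((p : ℕ) : 𝓞 K) ∉ w.asIdeal →
          GaloisRep.IsUnramifiedAt w ((ofSMul N hN).coind (galFixing K F) hUopen) ∨
          (GreenbergSelmer.inertia w ≤ galFixing K F ∧ ∃ τ ∈ GreenbergSelmer.inertia w, ε τ ≠ 1))
        (hB5 : ∀ {s : absoluteGaloisGroup K ⧸ galFixing K F → absoluteGaloisGroup K}
          (hs : ∀ y, (s y : absoluteGaloisGroup K ⧸ galFixing K F) = y)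
          (hs1 : s ((1 : absoluteGaloisGroup K) : absoluteGaloisGroup K ⧸ galFixing K F) = 1)
          (φ : contOneCocycles (discreteTopRep (galFixing K F) N')),
          galoisCohomology.localization (((ofSMul N hN).coind (galFixing K F) hUopen).tateDual (p ^ M)) (Sum.inr vbar) 1
              (cohomologyMap (coindTateDualMor (ofSMul N hN) (ofSMul N' hN') (galFixing K F) B hUopen hB) 1
                (shapiroLift (ofSMul N' hN').toTopRep (galFixing K F) hUopen hs hs1 (oneCocycleClass _ φ))) ∈
            (LocalInvariants.canonical K (p ^ M)).dualLocalCondition ((ofSMul N hN).coind (galFixing K F) hUopen) (Sum.inr vbar)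
              (DiscreteGaloisModule.unramifiedSubgroup (GaloisRep.toLocal vbar ((ofSMul N hN).coind (galFixing K F) hUopen)) 1) →
          ∀ β : (AlgebraicClosure K)ˣ,
            (∀ u : galFixing K F', Additive.toMul (ι' (φ.1 ⟨u, hU' u.2⟩)) = (u : absoluteGaloisGroup K) • β / β) →
            ∀ b : F', ((b : F') : AlgebraicClosure K) = ((β ^ p ^ M : (AlgebraicClosure K)ˣ) : AlgebraicClosure K) →
            ∀ w' : vbar.Extension (𝓞 F'),
              ((p ^ M : ℕ) : ℤ) ∣ WithZero.log (w'.1.valuation F' b) ∨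
              ∃ 𝔓 : Ideal (absIntegers (𝓞 K) K),
                𝔓.comap (ringOfIntegersToIntegralClosure (k := K) (Ω := AlgebraicClosure K) F') = w'.1.asIdeal ∧
                ∃ s ∈ galFixing K F, ε s ≠ 1 ∧ s • 𝔓 = 𝔓)
        (T : Finset (HeightOneSpectrum (𝓞 K))), (∀ w ∈ T, ((p : ℕ) : 𝓞 K) ∉ w.asIdeal ∨ w = vbar) →
        ∀ τ₀ : (w : HeightOneSpectrum (𝓞 K)) →
          DoubleCoset.Quotient (decomp (K := K) w : Set (absoluteGaloisGroup K)) (galFixing K F : Set (absoluteGaloisGroup K)) →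
            subgroupH1 (decompIn (galFixing K F) w) N₀,
        ∃ z : subgroupH1 (galFixing K F) N,
          (∀ w ∈ T, ∀ q : DoubleCoset.Quotient (decomp (K := K) w : Set (absoluteGaloisGroup K))
              (galFixing K F : Set (absoluteGaloisGroup K)),
            resOfLe N (inertiaIn_le_decompIn (galFixing K F) w)
              (resH1Hom (decompInToH (galFixing K F) w) (AddMonoidHom.id N) (fun _ _ ↦ rfl)
                  (conjH1 (galFixing K F) N q.out z) -
                resH1Hom (ContinuousMonoidHom.id (decompIn (galFixing K F) w)) j (fun _ m ↦ hj _ m) (τ₀ w q)) = 0) ∧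
          (∀ w : HeightOneSpectrum (𝓞 K), w ∉ T → (((p : ℕ) : 𝓞 K) ∉ w.asIdeal ∨ w = vbar) →
            ∀ σ : absoluteGaloisGroup K, conjH1 (galFixing K F) N σ z ∈ GreenbergVatsal2000.unramifiedKer (galFixing K F) N w) := by
  have hp : p.Prime := Fact.out
  obtain ⟨M, hkM, hM⟩ := KummerUDict.exists_level_resH1Hom_eq_zero_of_local_twisted_ramified (p := p) hK hv hvbar hne F F' ε hU' hεU'
    hker k
  refine ⟨M, hkM, ?_⟩
  intro N₀ _ _ _ _ _ N _ _ _ _ _ N₀' _ _ _ _ N' _ _ _ _ hN₀ hN hN₀' hN' hMN hMN' j hj B hB hBbij B₀ hB₀ jD hjD hBj ι' hι'inj hι' ι₀' hι₀'inj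
    hι₀' hι₀'surj htι Sε hSε hram hB5 T hT τ₀
  -- places: off `{v, v̄}` the prime `p` is invertible
  have hpw : ∀ w : HeightOneSpectrum (𝓞 K), w ≠ v → w ≠ vbar → ((p : ℕ) : 𝓞 K) ∉ w.asIdeal := fun w h1 h2 h ↦ by
    rcases hall w h with h' | h' <;> [exact h1 h'; exact h2 h']
  have hpMw : ∀ w : HeightOneSpectrum (𝓞 K), ((p : ℕ) : 𝓞 K) ∉ w.asIdeal → ((p ^ M : ℕ) : 𝓞 K) ∉ w.asIdeal := fun w h hM' ↦ by
    rw [Nat.cast_pow] at hM'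
    exact h (w.isPrime.mem_of_pow_mem M hM')
  have hvne : ∀ w : HeightOneSpectrum (𝓞 K), (((p : ℕ) : 𝓞 K) ∉ w.asIdeal ∨ w = vbar) → w ≠ v := by
    rintro w (h | rfl)
    · exact fun h' ↦ h (h' ▸ hv)
    · exact hne
  -- representatives of `Γ_K ⧸ (galFixing K F)`
  obtain ⟨s, hs, hs1⟩ := exists_reps_one (N := galFixing K F)
  -- the coinduced intertwining map of `j`
  let ιc : ((ofSMul N₀ hN₀).coind (galFixing K F) hUopen).toContRepresentation →ⁱL ((ofSMul N hN).coind (galFixing K F) hUopen).toContRepresentation :=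
    { toContinuousLinearMap :=
        ⟨{ toFun := fun φ y ↦ j (φ y)
           map_add' := fun φ ψ ↦ funext fun y ↦ by
             change j ((φ + ψ) y) = j (φ y) + j (ψ y)
             rw [Pi.add_apply, map_add]
           map_smul' := fun c φ ↦ funext fun y ↦ by
             change j ((c • φ) y) = c • j (φ y)
             rw [Pi.smul_apply, map_zsmul] }, continuous_of_discreteTopology⟩
      isIntertwining' := fun σ ↦ by
        ext φ y
        change j (σ • φ (σ⁻¹ • y)) = σ • j (φ (σ⁻¹ • y))
        exact hj σ _ }
  have hιc : ∀ (φ : absoluteGaloisGroup K ⧸ (galFixing K F) → N₀) (y : absoluteGaloisGroup K ⧸ (galFixing K F)), ιc φ y = j (φ y) := fun _ _ ↦ rfl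
  -- the bad set `S = ∞ ∪ {v, v̄} ∪ T` and the Selmer structure `𝓕 = (⊤ at v, ∞ | unramified elsewhere)`
  let S : Finset (Place K) :=
    (Finset.univ.image Sum.inl) ∪ (({Sum.inr v, Sum.inr vbar} ∪ T.image Sum.inr) ∪ Sε.image Sum.inr)
  have hSinl : ∀ w : InfinitePlace K, (Sum.inl w : Place K) ∈ S := fun w ↦
    Finset.mem_union_left _ (Finset.mem_image_of_mem _ (Finset.mem_univ w))
  have hSv : (Sum.inr v : Place K) ∈ S :=
    Finset.mem_union_right _ (Finset.mem_union_left _ (Finset.mem_union_left _ (by simp)))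
  have hSvbar : (Sum.inr vbar : Place K) ∈ S :=
    Finset.mem_union_right _ (Finset.mem_union_left _ (Finset.mem_union_left _ (by simp)))
  have hST : ∀ w ∈ T, (Sum.inr w : Place K) ∈ S := fun w hw ↦
    Finset.mem_union_right _ (Finset.mem_union_left _ (Finset.mem_union_right _ (Finset.mem_image_of_mem _ hw)))
  have hSε' : ∀ w ∈ Sε, (Sum.inr w : Place K) ∈ S := fun w hw ↦
    Finset.mem_union_right _ (Finset.mem_union_right _ (Finset.mem_image_of_mem _ hw))
  have hSout : ∀ w : HeightOneSpectrum (𝓞 K), (Sum.inr w : Place K) ∉ S → w ≠ v ∧ w ≠ vbar ∧ w ∉ Sε := fun w hw ↦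
    ⟨fun h ↦ hw (h ▸ hSv), fun h ↦ hw (h ▸ hSvbar), fun h ↦ hw (hSε' w h)⟩
  let 𝓕 : SelmerStructure ((ofSMul N hN).coind (galFixing K F) hUopen) := fun pl ↦
    match pl with
    | Sum.inl _ => ⊤
    | Sum.inr w => if w = v then ⊤ else DiscreteGaloisModule.unramifiedSubgroup (GaloisRep.toLocal w ((ofSMul N hN).coind (galFixing K F) hUopen)) 1
  have h𝓕v : 𝓕 (Sum.inr v) = ⊤ := by
    change (if v = v then ⊤ else _) = ⊤
    rw [if_pos rfl]
  have h𝓕w : ∀ w : HeightOneSpectrum (𝓞 K), w ≠ v →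
      𝓕 (Sum.inr w) = DiscreteGaloisModule.unramifiedSubgroup (GaloisRep.toLocal w ((ofSMul N hN).coind (galFixing K F) hUopen)) 1 := fun w hw ↦ by
    change (if w = v then ⊤ else _) = _
    rw [if_neg hw]
  have hS : ∀ w : HeightOneSpectrum (𝓞 K), (Sum.inr w : Place K) ∉ S →
      ((p ^ M : ℕ) : 𝓞 K) ∉ w.asIdeal ∧ GaloisRep.IsUnramifiedAt w ((ofSMul N hN).coind (galFixing K F) hUopen) := fun w hw ↦
    ⟨hpMw w (hpw w (hSout w hw).1 (hSout w hw).2.1),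
      hSε w (hSout w hw).2.2 (hpw w (hSout w hw).1 (hSout w hw).2.1)⟩
  have h𝓕S : 𝓕.IsUnramifiedOutside S := ⟨hSinl, fun w hw ↦ h𝓕w w (hSout w hw).1⟩
  have h𝓕u : ∀ w : HeightOneSpectrum (𝓞 K), (((p : ℕ) : 𝓞 K) ∉ w.asIdeal ∨ w = vbar) →
      𝓕 (Sum.inr w) = DiscreteGaloisModule.unramifiedSubgroup (GaloisRep.toLocal w ((ofSMul N hN).coind (galFixing K F) hUopen)) 1 :=
    fun w hw ↦ h𝓕w w (hvne w hw)
  -- B2d with B2c, the displayed `hPN` discharged by the class-level (PRO-NULL)_U and `hB5`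
  refine exists_layerClass_of_layerProNull (hM := hN) (U := galFixing K F) (hU := hUopen) (hs := hs) (hs1 := hs1) (hM' := hN') (B := B)
    (hB := hB) (hM₀ := hN₀) (hM₀' := hN₀') (B₀ := B₀) (hB₀ := hB₀) (ιc := ιc) (j := j) (hιc := hιc) (jD := jD) (hjD := hjD)
    (hBj := hBj) p hMN hj hBbij vbar S hS 𝓕 h𝓕S h𝓕u T hT hST τ₀ ?_
  intro y' hloc hunr hdual
  obtain ⟨φ, rfl⟩ := oneCocycleClass_surjective (discreteTopRep (galFixing K F) N') y'
  exact hM ι' hι'inj hι' hMN' ι₀' hι₀'inj hι₀' hι₀'surj jD hjD htι φ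
    (hloc v h𝓕v)
    (fun w hwv hwvbar ↦ (hram w (hpw w hwv hwvbar)).imp
      (fun hu σ ↦ hunr w (h𝓕w w hwv) (hpMw w (hpw w hwv hwvbar)) hu σ) id)
    (hB5 hs hs1 φ (by
      have h := hdual (Sum.inr vbar)
      rw [h𝓕w vbar hne] at h
      exact h))

end Summit.BirchSwinnertonDyer.BirchSwinnertonDyer.Theorems.PrintCf2.LayerShapiro

end
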